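import Mathlib
import HarnessLib
import HarnessLib.Audit
import Summits.RiemannHypothesis.Statement

/-!
Route: CharacterSums

CLOSED (refuted) 2026-08-17T07:00:02Z by planner-rfix-RiemannHypothesis-CharacterSums-31f5923f-0 — reason: refuted:stmt-RiemannHypothesis-16980 (ConreyPositivity) by Summit.RiemannHypothesis.RiemannHypothesis.Theorems.CharacterSumsConreyPositivity_refuted — note: refuted:ConreyPositivity by Summit.RiemannHypothesis.RiemannHypothesis.Theorems.CharacterSumsConreyPositivity_refuted @ ee0c71b92032 (window flip: a prime q ≡ 3 (8) imitating on [1,2^17] the pattern "λ flipped to +1 at p ≡ 2049..4095 mod 4096" has f_q(1/4096) < 0). SUBSTANTIVE for the thesis: "posit. The file is kept as the record of this route; refuted decls are indexed as negative knowledge (`ledger negatives`).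

# Route CharacterSums — RH from Conrey's Legendre-symbol sine sums — the Cesàro character sum never
beats the class number (Conrey 2024, Conj 1 / Thm 3)

It suffices to show X = CONREY POSITIVITY (open-question harvest, Conrey2024CharacterSums =
arXiv:2404.19647, Acta Arith. 2024,
Conjecture 1 ∩ the hypothesis of his Theorem 3, printed p.4): for every prime q ≡ 3 (mod 8) and
every x ∈ [0, 1/4],
f_q(x) := Σ_{n≥1} (n/q)·sin(2πnx)/n² ≥ 0, (n/q) the Legendre symbol. By Conrey's Theorem 4 /
Corollary 1 (support
FiniteForm) f_q(x) = (2π²x/√q)(S_q(q/2) − S_q(qx)) with the Cesàro character sum S_q(N) = Σ_{n≤N}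
(n/q)(1 − n/N) and
S_q(q/2) = (√q/π)L(1,χ_q) = h(−q), so X is, prime by prime, the FINITE inequality "S_q(N) ≤ h(−q)
for 0 < N ≤ q/4"
(checked by Bober for all primes q ≡ 3 (8) below 10⁹, Conrey Remark 2; by the planner below 12 000).
X ⇒ RH is Conrey's
Theorem 3 = Theorem 1 (crux LiouvilleSineCriterion: the Liouville sine series f(x) = Σ λ(n)
sin(2πnx)/n² one-signed
near 0 forces RH, by Landau's lemma) after the CRT/reciprocity/Dirichlet imitation of λ by Legendre
symbols (crux
CharacterImitation). No card realised (literature lens); nearest hub objects: route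
OneSidedGoldbach, card smoothed-polya-sign-law.
Lean: `∀ q : ℕ, q.Prime → q % 8 = 3 → ∀ x : ℝ, 0 ≤ x → x ≤ 1 / 4 → 0 ≤ ∑' n : ℕ, (jacobiSym (n : ℤ)
q : ℝ) * Real.sin (2 * Real.pi * n * x) / (n : ℝ) ^ 2`

## Assembly
Pure logic (certified: `closes (h₁ : ConreyPositivity) (h₂ : LiouvilleSineCriterion) (h₃ :
CharacterImitation) : Summit.RiemannHypothesis := Summit.RiemannHypothesis_iff.mpr (h₂ (1/4) (by
norm_num) (h₃ h₁))`, sorry-free in Sketch.lean): CharacterImitation turns ConreyPositivity into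
positivity of the Liouville sine series on [0, 1/4]; LiouvilleSineCriterion at δ = 1/4 gives
Mathlib's RiemannHypothesis, which is the summit by `Summit.RiemannHypothesis_iff`.

Rationale: WHY THIS LINE. Conrey (Conrey2024CharacterSums, Thm 1, proof §4 READ) shows that one-signedness near
0⁺ of the twice-smoothed Liouville
statistic f(x) = Σ λ(n) sin(2πnx)/n² implies RH through Landau's lemma on ∫₀^∞ f(x)x^{s−2}dx =
πX(1−s)ζ(2s+2)/((1−s)ζ(s+1))
(MontgomeryVaughan2007 Lemma 15.1; the tree already PROVES the order-0 sibling
`Literature.NumberTheory.LFunctions.riemannHypothesis_of_liouvilleSum_oneSided`),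
and — the imported mechanism, from the GL(1) quadratic family — that by the Chinese remainder
theorem, quadratic
reciprocity and Dirichlet's theorem the Legendre symbols of primes q ≡ 3 (mod 8) imitate λ on [1, N]
for every N, so
that positivity of the FINITE objects f_q (Thm 4: a Cesàro character sum against the class number
h(−q)) suffices
(Thm 3; Remark 3: "information solely about Dirichlet L-functions potentially gives the Riemann
Hypothesis … different
L-functions somehow know about each other"). Unlike the false sharp-cutoff sign laws (Pólya, Turán,
Mertens:
HaselgroveMathematika1958, BorweinFergusonMossinghoff2008) the n^{−2}·sine weight makes the
zero-side coefficients
absolutely summable (Thm 2: under RH + simple zeros, Σ_{|γ|≤1000} |X(2−ρ)ζ(2ρ)/((2−ρ)ζ′(ρ))| = 0.265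
against the drift
−4π/(3ζ(½)) = 2.868), so positivity is expected WITH MARGIN. The author stops in print (§7, p.11):
"Conjecture 1 has
been checked for primes up to 10⁹ … However, probabilistic grounds call into question its truth for
all primes
q ≡ 3 mod 8. … Presumably something like this is correct (and should be equivalent to RH), but it is
not clear how to
proceed"; and (p.12, Conj 2): "maybe there is some hope to prove Conjecture 2". No existing route or
card of the summit
uses Dirichlet characters, class numbers or an auxiliary family of L-functions as its lever (31
theses read; grep of
Ideas/ and Theses/ for 2404.19647: 0 hits; `lit citing`: 0).

RANKED CRUXES. #2 ConreyPositivity (crux) — for every prime q ≡ 3 (mod 8) and every x ∈ [0, 1/4],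
Σ_{n≥1} (n/q) sin(2πnx)/n² ≥ 0 (Conrey 2024 Conjecture 1 restricted to what Theorem 3 consumes;
equivalently, by FiniteForm, S_q(N) ≤ S_q(q/2) = h(−q) for all 0 < N ≤ q/4). [difficulty:
open-problem] (why it might fail: Conrey §7 p.11: "probabilistic grounds call into question its
truth for all primes q ≡ 3 mod 8" — a sporadic huge q with a Cesàro sum S_q(N) > h(−q), N ≤ q/4
(Baker–Montgomery-type oscillation) kills it as stated; repair = imitating-subsequence form.)
[Conrey2024CharacterSums, arXiv:2404.19647, BakerMontgomery1990, GranvilleSoundararajan2007PV,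
BoberGoldmakherGranvilleKoukoulopoulos2018, LevinPomeranceSoundararajan2010]
#3 LiouvilleSineCriterion (crux) — Conrey 2024 Theorem 1 ("the 1/4 can be replaced by any positive
constant"): if for some δ > 0 the Liouville sine series f(x) = Σ λ(n) sin(2πnx)/n² is ≥ 0 on [0, δ],
then the Riemann Hypothesis holds. THEOREM IN PRINT (2-page proof: Mellin identity on 0 < Re s < 1,
periodicity makes the tail integral entire, Landau's lemma, rightmost real pole of
πX(1−s)ζ(2s+2)/((1−s)ζ(s+1)) at s = −1/2) — a formalisation crux on top of the tree's
LiouvilleOneSided / Landau modules. [difficulty: L] (why it might fail: mathematically it cannot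
(Conrey 2024 Thm 1, published); risk = transcription: the Mellin identity needs absolute convergence
on 0 < Re s < 1 (|f(x)| ≪ x log(1/x) at 0⁺) and ζ(σ+1) ≠ 0 for real σ > −1/2 — both standard.)
[Conrey2024CharacterSums, MontgomeryVaughan2007, BorweinFergusonMossinghoff2008]
#4 CharacterImitation (crux) — the reduction inside Conrey 2024 Theorem 3: positivity of f_q on [0,
1/4] for every prime q ≡ 3 (mod 8) implies positivity of the Liouville series f on [0, 1/4] (for
every N a prime q ≡ 3 (8) has (n/q) = λ(n) for all n ≤ N — CRT + quadratic reciprocity + Dirichlet —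
and |f(x) − f_q(x)| ≤ 2 Σ_{n>N} n^{−2} < 2/N). THEOREM IN PRINT; Mathlib has
`Nat.infinite_setOf_prime_and_eq_mod` and `jacobiSym.quadratic_reciprocity_three_mod_four`.
[difficulty: M] (why it might fail: it cannot mathematically (half-page proof in print, p.4); risk =
only the bookkeeping of the imitating residue classes (q ≡ 3 (8) forces (2/q) = −1 = λ(2); odd p ≤ N
handled by reciprocity) — see bc/special.lean: 163 imitates λ up to 40, 43 up to 10.)
[Conrey2024CharacterSums, arXiv:2404.19647]
#9 FiniteForm (support) — Conrey 2024 Theorem 4 / Corollary 1: for a prime q ≡ 3 (mod 8) and x ≥ 0,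
f_q(x) = (2π²x/√q)(S_q(q/2) − S_q(qx)) with S_q(N) = Σ_{1≤n≤N} (n/q)(1 − n/N); it makes crux
ConreyPositivity a finite inequality per q (and S_q(q/2) = (√q/π)L(1,χ_q) = h(−q) for q > 3).
[difficulty: provable-now] [Conrey2024CharacterSums]
#9 ImitatingPrimes (support) — for every N there is a prime q ≡ 3 (mod 8), q > N, whose Legendre
symbol agrees with λ on [1, N] (CRT + quadratic reciprocity + Dirichlet's theorem; the arithmetic
input of CharacterImitation; instances 43 (N = 10) and 163 (N = 40) certified in bc/special.lean).
[difficulty: provable-now] [Conrey2024CharacterSums]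

TWO-LAYER PLAN. Foreseen glued splits (nothing filed now): ConreyPositivity ⇐ FiniteForm → CesaroMax
→ ConreyPositivity (CesaroMax: S_q(N) ≤ S_q(q/2) for 0 < N ≤ q/4; proved composition in
bc/ConreyPositivity_birth.lean), and then CesaroMax by RANGE OF N: ShortRange (N ≤ q^{1/2−ε}:
Siegel/Conrey §5, provable ineffectively, effective only via Goldfeld–Gross–Zagier for N ≪ log q) →
LongRange (q^{1/2−ε} < N ≤ q/4: the content; BGGK structure of large character sums / smoothed
Pólya–Vinogradov against (√q/π)L(1,χ)) → CesaroMax. Alternative child of ConreyPositivity: Conrey's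
Conjecture 2 (p.12: q ∤ numerator of h(q) − S_q(qx) for rational x < 1/2) + his Proposition 1 (zeros
of f_q are rational, PROVED in print) + f_q(x) = 2πxL(1,χ_q)(1+o(1)) > 0 at 0⁺.
LiouvilleSineCriterion ⇐ MellinIdentity → TailEntire → LandauEndgame
(bc/LiouvilleSineCriterion_birth.lean). CharacterImitation ⇐ ImitatingPrimes → TailTransfer
(bc/CharacterImitation_birth.lean).

KILL CRITERIA. A certified pair (q prime ≡ 3 (8), N ≤ q/4) with S_q(N) > h(−q) refutes
ConreyPositivity AS STATED (class misstated: RH untouched; it also answers Conrey's printed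
question) — repair once by `--restate` to the imitating-subsequence form W: ∀ N ∃ prime q ≡ 3 (8)
imitating λ on [1,N] with f_q ≥ 0 on [0,1/4] (same closes after restating CharacterImitation to
consume W; Conrey §7: "presumably … equivalent to RH"); if W is then refuted (every imitating q
beyond some N fails) close `refuted:ConreyPositivity`. A proof elsewhere of RH moots the route; a
proof that f(x) < 0 for some x ∈ (0,1/4] refutes RH itself (Thm 2 calibrates against it).
LiouvilleSineCriterion / CharacterImitation cannot be refuted (theorems in print); a bounce there is
a typing repair.

NOT DECOMPOSED YET. The range split of CesaroMax (constants depend on Siegel's ineffective theorem —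
deliberately not typed at open); the weakest-needed forms of the deciding crux (∃ δ > 0 uniform in q
instead of δ = 1/4; the imitating-subsequence form W) — kept in reserve as repair restatements,
because the printed statement (hypothesis of Thm 3, Bober-verified to 10⁹) is the killable one;
Conrey's 7 (mod 8) variant (his printed pair "max of S_q on [0,q/4] at N = q/4" ∧ "T(q) = Σ_{n≤q/4}
n(n/q) > 0") is NOT filed: the planner's check refutes the first half at q = 1423 (max S = 1.2 at N
= 5 > S_q(q/4) = 0.56, h = 9), while the needed inequality S_q(N) ≤ h holds there; Conjecture 3
(test_a(p,q) > 0) and the λ-values f(a/q) via L(4,χ)/L(2,χ) (§8) are lines for crux-ideation, not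
items.

CHEAPEST FALSIFIER. Extend Bober's verification (Conrey Remark 2: all primes q ≡ 3 (8) up to 10⁹
satisfy Conjecture 1 on [0,1/2]) with ONE batched kit job over 10⁹ < q < 10¹⁰ using FiniteForm (O(q)
per prime with prefix sums; large Cesàro sums only occur for N/q near rationals with small
denominator — BGGK — so a windowed scan suffices), and run the
Baker–Montgomery/random-multiplicative heuristic for the probability that S_q(N) > h(−q) for some N
≤ q/4 as q → ∞ (summable or not?). Planner ran num/conrey_check.py (pure python, primes < 12 000):
363 primes q ≡ 3 (8), 0 violations, min (h − max_N S_q(N))/√q = 0.039 at q = 163; the 7 (mod 8) "max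
at q/4" phrasing fails at q = 1423 (hence not filed).

NUMBERS. Conrey Thm 2 (under RH + simple zeros): f(x) = −(4π²/(3ζ(½)))x^{3/2} − … + Σ_ρ c_ρ x^{2−ρ},
−4π/(3ζ(½)) = 2.86834…, Σ_{|γ|≤1000} |c_ρ| = 0.264954… (margin ≈ 10×). Verified ranges: f(x) ≥ 0 for
0.011 ≤ x ≤ 1/4 (Conrey Cor 2 + Euler products); Conjecture 1 for primes ≤ 10⁹ (Bober); planner:
primes < 12 000 on [0, 1/4]. Imitation lengths: (n/163) = λ(n) for n ≤ 40 (Conrey p.4;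
bc/special.lean), (n/43) for n ≤ 10. Smoothed Pólya–Vinogradov: |Σ_{n≤N} χ(n)(1 − n/N)|-type sums ≪
√q with absolute constant (LevinPomeranceSoundararajan2010) vs the target constant L(1,χ_q)/π, which
ranges over [q^{−ε}, c loglog q]. Items at open: 6 (3 cruxes, 2 supports, 1 assembly).

DEFINITION REQUESTS. None (jacobiSym, ArithmeticFunction.liouville, Real.sin, tsum, riemannZeta are
Mathlib). Cite facts wanted for grounders: "fact: Conrey 2024 Thm 1" and "fact: Conrey 2024 Thm
3/Thm 4" (Conrey2024CharacterSums) — materialised here as the crux/support items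
LiouvilleSineCriterion, CharacterImitation, FiniteForm to be PROVED in Theorems (the tree is
axiom-free; the sibling order-0 statement is already proved in
Literature.NumberTheory.LFunctions.LiouvilleOneSidedRH).

Novelty: Searches (2026-08-17): corpus frontier.json (60 rows since 2023) + reads.jsonl; questions.tsv (400
rows) PLUS the truncated tail rows 401–475 of INDEX-QUESTIONS.tsv (where Conrey 2024 sits, row 448
[Q217–Q218]); `lit read` at page level of arXiv:2605.24363, 2601.12133, 2509.18963, 2511.02106,
2607.12084, 1309.0055, Ki–Kim 2000 (doi:10.1215/s0012-7094-00-10413-9), 2404.19647 (pp.1–14); `lit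
citing arxiv:2404.19647` / doi:10.4064/aa230530-13-11 (local + api): 0 citing works; `lit search`
openalex/s2 rate-limited (HTTP 429, to be re-run by the refuter), zbmath "sums of Legendre symbols
class number maximum Cesaro inequality Riemann hypothesis": 0; `lit galaxy search "Character sums
and the Riemann Hypothesis Conrey" --star all`: 0; grep of all 142 idea cards and 31 theses for
2404.19647 / "f_q": 0; `ledger negatives`: 1 unrelated entry; lean search: tree has
LiouvilleOneSidedRH (Pólya/Ingham order 0, proved), FeketePolynomial, PrimitiveQuadraticCharacter —
no sine-kernel or character-transfer statement.
Nearest prior art found: Conrey2024CharacterSums itself (the criterion, the transfer and the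
conjecture are HIS; this route files them); on the hub, route OneSidedGoldbach (one-sided Goldbach
average + Landau, ζ-internal) and
Literature.NumberTheory.LFunctions.riemannHypothesis_of_liouvilleSum_oneSided (Pólya 1919/Ingham
1942, proved); cards smoothed-polya-sign-law and polya-square-part-tilt (smoothed λ sign laws,
variant, no character transfer).
Delta: the first line on this sum  [refs: 10.1215/s0012-7094-00-10413-9, 10.4064/aa230530-13-11, 2605.24363, 2404.19647, doi:10.1215/s0012-7094-00-10413-9, arxiv:2404.19647, doi:10.4064/aa230530-13-11]

Barriers (technique_class: landau-one-signed, character-sum-transfer): - technique_class: landau-one-signed, character-sum-transfer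
- Literature.Barriers.RiemannHypothesis.LiouvilleSignConjectures: Pólya's L(x) ≤ 0 and Turán's
Σλ(n)/n > 0 are false (Haselgrove 1958, BFM 2008) and Ingham's theorem makes any eventually
one-signed ORDER-0/1 Liouville statistic imply linear dependence of the ordinates; evaded in kind —
the kernel sin(2πnx)/n² is two orders smoother, its explicit formula has absolutely summable zero
coefficients (Conrey Thm 2: 0.265 vs 2.868), so positivity is consistent with LI and expected with
margin; the statistic is probed at x → 0⁺ (period-1 function), not x → ∞.
- Literature.Barriers.RiemannHypothesis.MertensDisproof: same moral (sharp cutoff, divergent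
Σ1/|ρζ′(ρ)|); not engaged — no Möbius sum, smooth weight.
- Literature.Barriers.RiemannHypothesis.TuranPartialSums: Turán's Dirichlet-polynomial positivity
and its Cesàro version are refuted (Montgomery 1983; TuranPartialSumsCesaroRefutation); our object
is not a partial sum of ζ and carries the second-order weight plus the odd sine kernel; conceded
that "one more order of smoothing" is exactly the kind of hope those refutations punish — Conrey's
Thm 2 margin is the quantitative reason it is different here.
- Literature.Barriers.RiemannHypothesis.FeketePolyaPositivity: for χ_{−163} every iterated summatory
function S_k(N, χ) goes negative (Heilbronn; proved in tree), killing Fekete–Pólya LOWER-bound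
positivity; ConreyPositivity is an UPPER bound S₂(N)/N ≤ h(−q) on the initial q

History (route lifecycle, newest last):
- 2026-08-17T06:28:14Z · BROKEN — ConreyPositivity (stmt-RiemannHypothesis-16980, crux) refuted by Summit.RiemannHypothesis.RiemannHypothesis.Theorems.CharacterSumsConreyPositivity_refuted @ ee0c71b92032 (refuter-rattack-stmt-RiemannHypothesis-16980-0)
- 2026-08-17T07:00:02Z · CLOSED refuted — refuted:stmt-RiemannHypothesis-16980 (ConreyPositivity) by Summit.RiemannHypothesis.RiemannHypothesis.Theorems.CharacterSumsConreyPositivity_refuted (planner-rfix-RiemannHypothesis-CharacterSums-31f5923f-0)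

sub-problem: RiemannHypothesis · status: closed(refuted) · opened planner-plan-lens3-RiemannHypothesis-oqh-0 2026-08-17T00:53:56Z · rev 0 · ledger route-RiemannHypothesis-CharacterSums
GENERATED by the gate from the ledger (D-0016/17). Provers cite these decls: `theorem foo : Summit.RiemannHypothesis.RiemannHypothesis.Theses.CharacterSums.<Decl> := …` in Summits/RiemannHypothesis/RiemannHypothesis/Theorems/<Name>.lean.
-/

namespace Summit.RiemannHypothesis.RiemannHypothesis.Theses.CharacterSums

open scoped BigOperators Topology Manifold Classical MeasureTheory ProbabilityTheory Matrix InnerProductSpace ComplexConjugate ContinuousMap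
open Filter Set Function TopologicalSpace MeasureTheory

attribute [summit_statement] _root_.Summit.RiemannHypothesis

open Summit

/-- item stmt-RiemannHypothesis-16980 · crux · rank 2 · closed · refuted by Summit.RiemannHypothesis.RiemannHypothesis.Theorems.CharacterSumsConreyPositivity_refuted @ ee0c71b92032 (refuter) · by planner
why it might fail: Conrey §7 p.11: "probabilistic grounds call into question its truth for all primes q ≡ 3 mod 8" — a sporadic huge q with a Cesàro sum S_q(N) > h(−q), N ≤ q/4 (Baker–Montgomery-type oscillation) kills it as stated; repair = imitating-subsequence form.
sources: Conrey2024CharacterSums, arXiv:2404.19647, BakerMontgomery1990, GranvilleSoundararajan2007PV, BoberGoldmakherGranvilleKoukoulopoulos2018, LevinPomeranceSoundararajan2010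
[crux] for every prime q ≡ 3 (mod 8) and every x ∈ [0, 1/4], Σ_{n≥1} (n/q) sin(2πnx)/n² ≥ 0 (Conrey
2024 Conjecture 1 restricted to what Theorem 3 consumes; equivalently, by FiniteForm, S_q(N) ≤
S_q(q/2) = h(−q) for all 0 < N ≤ q/4). [difficulty: open-problem] -/
@[route_item "route-RiemannHypothesis-CharacterSums"]
def ConreyPositivity : Prop :=
  ∀ q : ℕ, q.Prime → q % 8 = 3 → ∀ x : ℝ, 0 ≤ x → x ≤ 1 / 4 → 0 ≤ ∑' n : ℕ, (jacobiSym (n : ℤ) q : ℝ) * Real.sin (2 * Real.pi * n * x) / (n : ℝ) ^ 2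

/-- item stmt-RiemannHypothesis-16981 · crux · rank 3 · closed · moot by None · by planner
why it might fail: mathematically it cannot (Conrey 2024 Thm 1, published); risk = transcription: the Mellin identity needs absolute convergence on 0 < Re s < 1 (|f(x)| ≪ x log(1/x) at 0⁺) and ζ(σ+1) ≠ 0 for real σ > −1/2 — both standard.
sources: Conrey2024CharacterSums, MontgomeryVaughan2007, BorweinFergusonMossinghoff2008
[crux] Conrey 2024 Theorem 1 ("the 1/4 can be replaced by any positive constant"): if for some δ > 0
the Liouville sine series f(x) = Σ λ(n) sin(2πnx)/n² is ≥ 0 on [0, δ], then the Riemann Hypothesis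
holds. THEOREM IN PRINT (2-page proof: Mellin identity on 0 < Re s < 1, periodicity makes the tail
integral entire, Landau's lemma, rightmost real pole of πX(1−s)ζ(2s+2)/((1−s)ζ(s+1)) at s = −1/2) —
a formalisation crux on top of the tree's LiouvilleOneSided / Landau modules. [difficulty: L] -/
@[route_item "route-RiemannHypothesis-CharacterSums"]
def LiouvilleSineCriterion : Prop :=
  ∀ δ : ℝ, 0 < δ → (∀ x : ℝ, 0 ≤ x → x ≤ δ → 0 ≤ ∑' n : ℕ, (ArithmeticFunction.liouville n : ℝ) * Real.sin (2 * Real.pi * n * x) / (n : ℝ) ^ 2) → _root_.RiemannHypothesis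

/-- item stmt-RiemannHypothesis-16982 · crux · rank 4 · closed · moot by None · by planner
why it might fail: it cannot mathematically (half-page proof in print, p.4); risk = only the bookkeeping of the imitating residue classes (q ≡ 3 (8) forces (2/q) = −1 = λ(2); odd p ≤ N handled by reciprocity) — see bc/special.lean: 163 imitates λ up to 40, 43 up to 10.
sources: Conrey2024CharacterSums, arXiv:2404.19647
[crux] the reduction inside Conrey 2024 Theorem 3: positivity of f_q on [0, 1/4] for every prime q ≡
3 (mod 8) implies positivity of the Liouville series f on [0, 1/4] (for every N a prime q ≡ 3 (8)
has (n/q) = λ(n) for all n ≤ N — CRT + quadratic reciprocity + Dirichlet — and |f(x) − f_q(x)| ≤ 2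
Σ_{n>N} n^{−2} < 2/N). THEOREM IN PRINT; Mathlib has `Nat.infinite_setOf_prime_and_eq_mod` and
`jacobiSym.quadratic_reciprocity_three_mod_four`. [difficulty: M] -/
@[route_item "route-RiemannHypothesis-CharacterSums"]
def CharacterImitation : Prop :=
  (∀ q : ℕ, q.Prime → q % 8 = 3 → ∀ x : ℝ, 0 ≤ x → x ≤ 1 / 4 → 0 ≤ ∑' n : ℕ, (jacobiSym (n : ℤ) q : ℝ) * Real.sin (2 * Real.pi * n * x) / (n : ℝ) ^ 2) → ∀ x : ℝ, 0 ≤ x → x ≤ 1 / 4 → 0 ≤ ∑' n : ℕ, (ArithmeticFunction.liouville n : ℝ) * Real.sin (2 * Real.pi * n * x) / (n : ℝ) ^ 2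

/-- item stmt-RiemannHypothesis-16983 · support · rank 9 · closed · moot by None · by planner
sources: Conrey2024CharacterSums
[support] Conrey 2024 Theorem 4 / Corollary 1: for a prime q ≡ 3 (mod 8) and x ≥ 0, f_q(x) =
(2π²x/√q)(S_q(q/2) − S_q(qx)) with S_q(N) = Σ_{1≤n≤N} (n/q)(1 − n/N); it makes crux ConreyPositivity
a finite inequality per q (and S_q(q/2) = (√q/π)L(1,χ_q) = h(−q) for q > 3). [difficulty:
provable-now] -/
@[route_item "route-RiemannHypothesis-CharacterSums"]
def FiniteForm : Prop :=
  ∀ q : ℕ, q.Prime → q % 8 = 3 → ∀ x : ℝ, 0 ≤ x → (∑' n : ℕ, (jacobiSym (n : ℤ) q : ℝ) * Real.sin (2 * Real.pi * n * x) / (n : ℝ) ^ 2) = 2 * Real.pi ^ 2 * x / Real.sqrt q * ((∑ n ∈ Finset.Icc 1 ⌊(q : ℝ) / 2⌋₊, (jacobiSym (n : ℤ) q : ℝ) * (1 - (n : ℝ) / ((q : ℝ) / 2))) - ∑ n ∈ Finset.Icc 1 ⌊(q : ℝ) * x⌋₊, (jacobiSym (n : ℤ) q : ℝ) * (1 - (n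 : ℝ) / ((q : ℝ) * x)))

/-- item stmt-RiemannHypothesis-16984 · support · rank 9 · closed · moot by None · by planner
sources: Conrey2024CharacterSums
[support] for every N there is a prime q ≡ 3 (mod 8), q > N, whose Legendre symbol agrees with λ on
[1, N] (CRT + quadratic reciprocity + Dirichlet's theorem; the arithmetic input of
CharacterImitation; instances 43 (N = 10) and 163 (N = 40) certified in bc/special.lean).
[difficulty: provable-now] -/
@[route_item "route-RiemannHypothesis-CharacterSums"]
def ImitatingPrimes : Prop :=
  ∀ N : ℕ, ∃ q : ℕ, q.Prime ∧ q % 8 = 3 ∧ N < q ∧ ∀ n : ℕ, 1 ≤ n → n ≤ N → jacobiSym (n : ℤ) q = ArithmeticFunction.liouville n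

/-- item stmt-RiemannHypothesis-16985 · assembly · rank 1 · closed · moot by None · by planner
sources: Conrey2024CharacterSums
[assembly] ConreyPositivity → LiouvilleSineCriterion → CharacterImitation → the summit statement. -/
@[route_item "route-RiemannHypothesis-CharacterSums"]
def Assembly : Prop :=
  ConreyPositivity → LiouvilleSineCriterion → CharacterImitation → _root_.Summit.RiemannHypothesis

end Summit.RiemannHypothesis.RiemannHypothesis.Theses.CharacterSums
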